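import Literature.Computability.QuantumComplexity.TidyBlock
import HarnessLib

/-!
# Tidy subroutines with a query-dependent error: the weighted form of BBBV's Theorem 4.14

Topic `Literature/Computability/QuantumComplexity`, a corollary file of `TidyBlock.lean` (the tidy
block `tidyCirc D` — copy the query, run the decider `D`, copy its answer, run `D⁻¹`, uncopy — and
`tidyCirc_implOn`: if the decider errs with probability `≤ ε` on EVERY classical query, the block is
within `2√ε` of the XOR query gate on clean inputs). For subroutines whose error probability `ε(q)`
depends on the query and is small only ON AVERAGE over the queries actually asked — the situation of
Regev's iterative step (Regev 2009, Lemma 3.3: the `CVP` oracle of the quantum sampler of Lemma 3.14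
is the classical procedure of Lemma 3.4, correct with high probability over the INPUT SAMPLES, for each
query separately) — one needs the bound that the proof of Thm. 4.14 actually gives (Bennett–Bernstein–
Brassard–Vazirani 1997, proof of Thm. 4.14, p. 13 of arXiv:quant-ph/9701001: the error vectors of
distinct queries are orthogonal, each of squared norm twice the error probability of its query):

* **`TidyBlock.normSq_tidyCirc_sub_ideal_le`** — for every state `ψ` whose wires `≥ k + 1` read `0`,
  `‖T ψ − (U_A ⊗ 1) ψ‖₂² ≤ 4 · Σ_q ε(q) · w_ψ(q)`, where `ε(q) = errProb A D q` is the Born weight of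
  the wrong answers of `D` on `q` and `w_ψ(q) = Σ_b |ψ(q, b, 0…0)|²` the weight of the query `q` in `ψ`
  (`TidyBlock.queryWeight`; `Σ_q w_ψ(q) = ‖ψ‖₂²`, `sum_queryWeight`);
* `TidyBlock.normSq_tidyCirc_sub_ideal_le_of_le` — the same with any profile `e ≥ ε` pointwise, and
  `TidyBlock.normSq_tidyCirc_sub_ideal_le_uniform` — the uniform case recovered (`e ≡ ε` gives `4ε‖ψ‖²`).

Everything is proved; no named fact is introduced.

## References

* C. H. Bennett, E. Bernstein, G. Brassard, U. Vazirani, *Strengths and weaknesses of quantum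
  computing*, SIAM J. Comput. 26 (1997) 1510–1523, Thm. 4.14 and its proof (p. 13)
  [BennettBernsteinBrassardVazirani1997].
* O. Regev, *On lattices, learning with errors, random linear codes, and cryptography*, J. ACM 56
  (2009), art. 34, Lemmas 3.3, 3.4, 3.14 [Regev2009].
* M. A. Nielsen, I. L. Chuang, *Quantum Computation and Quantum Information*, CUP 2010, §3.2.5
  (uncomputation), §6.1.1 (the XOR oracle) [NielsenChuang2010].
-/

noncomputable section

namespace Literature.Computability.QuantumComplexity

namespace TidyBlock

open Cryptography Matrix

variable {k d : ℕ} (A : Language Bool) (D : QCircuit cliffordT (k + d))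

/-- **The weight of the query `q` in a state of the tidy register**: the squared amplitudes of the two
clean registers `|q, b, 0…0⟩`. [folklore] -/
def queryWeight (ψ : QReg (W k d) → ℂ) (q : QReg k) : ℝ := ∑ b : Bool, ‖ψ (reg q b (zf k d))‖ ^ 2

/-- Query weights are nonnegative. [folklore] -/
theorem queryWeight_nonneg (ψ : QReg (W k d) → ℂ) (q : QReg k) : 0 ≤ queryWeight ψ q :=
  Finset.sum_nonneg fun _ _ => by positivity

/-- **The query weights of a clean state sum to its squared norm.** [folklore] -/
theorem sum_queryWeight {ψ : QReg (W k d) → ℂ}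
    (hψ : SuppIn {z : QReg (W k d) | ∀ i : Fin (W k d), k + 1 ≤ (i : ℕ) → z i = false} ψ) :
    ∑ q, queryWeight ψ q = normSq ψ := by
  have hψ0 : ∀ z, z ∘ dE k d ≠ zf k d → ψ z = 0 := fun z hz => hψ z fun h => hz ((clean_iff z).1 h)
  exact (sum_eq_sum_reg (fun z => ‖ψ z‖ ^ 2) fun z hz => by rw [hψ0 z hz]; simp).symm

/-- **The weighted form of BBBV's Theorem 4.14.** On a clean input `ψ` (every wire `≥ k + 1` reads
`0`) the tidy block differs from the XOR query gate of `A` by a vector of squared norm at most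
`4 Σ_q errProb(q) · w_ψ(q)`: the error vectors of distinct queries are orthogonal and the one of `q`
has squared norm `2 errProb(q) |ψ(q,0) − ψ(q,1)|² ≤ 4 errProb(q) w_ψ(q)`.
[cite: BennettBernsteinBrassardVazirani1997, Thm. 4.14 (proof)] -/
theorem normSq_tidyCirc_sub_ideal_le (ψ : QReg (W k d) → ℂ)
    (hψ : SuppIn {z : QReg (W k d) | ∀ i : Fin (W k d), k + 1 ≤ (i : ℕ) → z i = false} ψ) :
    normSq ((tidyCirc D).mat *ᵥ ψ - ideal A k d *ᵥ ψ) ≤ 4 * ∑ q, errProb A D q * queryWeight ψ q := by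
  have hψ0 : ∀ z, z ∘ dE k d ≠ zf k d → ψ z = 0 := fun z hz => hψ z fun h => hz ((clean_iff z).1 h)
  -- coefficients and decomposition
  set c : QReg k → Bool → ℂ := fun q b => ψ (reg q b (zf k d)) with hc
  have hdec : ψ = ∑ q, ∑ b, c q b • basisState (reg q b (zf k d)) := by
    conv_lhs => rw [state_eq_sum_smul_basisState ψ]
    exact sum_eq_sum_reg (fun z => ψ z • basisState z) fun z hz => by rw [hψ0 z hz, zero_smul]
  -- the copied input
  have hcopy : Mc k d *ᵥ ψ = ∑ q, ∑ b, c q b • basisState (reg q b (padInput q d)) := by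
    conv_lhs => rw [hdec]
    simp only [Matrix.mulVec_sum, Matrix.mulVec_smul, Mc_mulVec_basisState, zf_apply, Bool.false_xor]
  -- the error vector
  have herrvec : (tidyCirc D).mat *ᵥ ψ - ideal A k d *ᵥ ψ =
      Mc k d *ᵥ ∑ q, (c q false - c q true) • Δ A D q := by
    have h1 : (tidyCirc D).mat *ᵥ ψ = Mc k d *ᵥ (Vd D *ᵥ (Ma k d *ᵥ (Ud D *ᵥ (Mc k d *ᵥ ψ)))) := by
      simp only [tidyCirc_mat, ← Matrix.mulVec_mulVec]
    have h2 : ideal A k d *ᵥ ψ = Mc k d *ᵥ (Mc k d *ᵥ (ideal A k d *ᵥ ψ)) := (Mc_mulVec_Mc_mulVec _).symm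
    rw [h1, h2, ← Matrix.mulVec_sub]
    congr 1
    rw [hcopy]
    conv_lhs => rw [hdec]
    simp only [Matrix.mulVec_sum]
    rw [← Finset.sum_sub_distrib]
    refine Finset.sum_congr rfl fun q _ => ?_
    have := sector A D q (c q)
    simp only [Matrix.mulVec_sum] at this
    exact this
  -- its squared norm, query by query
  rw [herrvec, normSq_Mc_mulVec, normSq_sum_of_disjoint]
  · simp_rw [normSq_smul, normSq_Δ]
    rw [Finset.mul_sum]
    refine Finset.sum_le_sum fun q _ => ?_
    have h1 := norm_sub_sq_le (c q false) (c q true)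
    have h3 := errProb_nonneg A D q
    have h4 : queryWeight ψ q = ‖c q false‖ ^ 2 + ‖c q true‖ ^ 2 := by
      rw [queryWeight, Fintype.sum_bool, add_comm]
    rw [h4]
    have h5 : 0 ≤ ‖c q false‖ ^ 2 + ‖c q true‖ ^ 2 := by positivity
    nlinarith
  · intro q q' z hqq
    by_cases hz : query z = q
    · right; simp [Δ_apply_eq_zero A D (fun h => hqq (hz.symm.trans h))]
    · left; simp [Δ_apply_eq_zero A D hz]

/-- The weighted form with any error profile `e ≥ errProb` (e.g. an upper bound one can compute).
[cite: BennettBernsteinBrassardVazirani1997, Thm. 4.14 (proof)] -/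
theorem normSq_tidyCirc_sub_ideal_le_of_le {e : QReg k → ℝ} (he : ∀ q, errProb A D q ≤ e q) (ψ : QReg (W k d) → ℂ)
    (hψ : SuppIn {z : QReg (W k d) | ∀ i : Fin (W k d), k + 1 ≤ (i : ℕ) → z i = false} ψ) :
    normSq ((tidyCirc D).mat *ᵥ ψ - ideal A k d *ᵥ ψ) ≤ 4 * ∑ q, e q * queryWeight ψ q := by
  refine (normSq_tidyCirc_sub_ideal_le A D ψ hψ).trans ?_
  gcongr with q _
  · exact queryWeight_nonneg ψ q
  · exact he q

/-- The uniform case recovered from the weighted form: `‖Tψ − Uψ‖₂² ≤ 4ε ‖ψ‖₂²`.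
[cite: BennettBernsteinBrassardVazirani1997, Thm. 4.14] -/
theorem normSq_tidyCirc_sub_ideal_le_uniform {ε : ℝ} (herr : ∀ q, errProb A D q ≤ ε) (ψ : QReg (W k d) → ℂ)
    (hψ : SuppIn {z : QReg (W k d) | ∀ i : Fin (W k d), k + 1 ≤ (i : ℕ) → z i = false} ψ) :
    normSq ((tidyCirc D).mat *ᵥ ψ - ideal A k d *ᵥ ψ) ≤ 4 * ε * normSq ψ := by
  have h := normSq_tidyCirc_sub_ideal_le_of_le A D (e := fun _ => ε) herr ψ hψ
  rwa [← Finset.mul_sum, sum_queryWeight hψ, ← mul_assoc] at h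

end TidyBlock

end Literature.Computability.QuantumComplexity

end
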